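import Summits.AtomisticToContinuum.BoseEinsteinCondensation.Theses.BECCutLineWeakDisorder
import Mathlib
import HarnessLib

/-!
# Crux `LandscapeBound` (stmt-AtomisticToContinuum-9087) — line `Sketch`
(card `fisher-sum-rule-deletion-removal`), lead skeleton

The crux (route `BECCutLineWeakDisorder`, rank 2, verbatim the hinge of retired `BECPalmLandscape`):
for every repulsive finite-range `v`, all small `ρ`, some `C` and all large `N = n + 1`, for EVERY
`δ > 0` there is a NONNEGATIVE `δ`-near-minimiser `Ψ ∈ TrialState (n+1) L`, `L = (N/ρ)^{1/3}`, with
`∫ L³ m(Y)²/s(Y)² dY ≤ C` (`m(Y) = ∫ Ψ(x,Y)² dx`, `s(Y) = ∫ Ψ(x,Y) dx`).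

## The line (card `fisher-sum-rule-deletion-removal`, ideator 3, round 1), as reshaped by the lead

The card's first lemma is the exact split `E_Q[R] = (N/n₀ᶠ)·(1 + χ²(Q‖ν₀))`: the landscape ratio of a
nonnegative function `f` on `(ℝ³)^{n+1}` factorises as

  `∫ L³ m²/s² = (L³ / ∫ s²) · [(∫ s²) · ∫ m²/s²]`,

the first factor being the inverse flat-mode condensate fraction `N/occ(φ₀)` and the second the
`χ² + 1` of the deletion law `Q = m dY` against the condensate-removal law `ν₀ = s² dY/∫ s²`. The
card's mechanism (Fisher sum rules (S1)–(S3) for the two bath zero-modes `s`, `√m` of a nonnegative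
EIGENFUNCTION, plus an effective Poincaré / log-Sobolev step for ONE observable under `ν₀`) is a
statement about the exact ground state, not about `C¹` trial states; so the skeleton puts the two
conjuncts on the canonical Feynman–Kac ground state `Ψ₀ = fkGroundState v (n+1) L` of the tree
(`GroundStateFeynmanKac.lean`; for BOUNDED measurable `v` it exists, is continuous, strictly positive
and nondegenerate by the PROVED named fact `GroundStateFeynmanKac_holds`), and transfers the bound
from `Ψ₀` to nonnegative `C¹` near-minimisers with the landed `CutLineWitness` toolkit
(`Theorems/BECCutLineWeakDisorderWitnessTransfer{Ratio,Trial,Witness}.lean`: dilate, mollify,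
normalise; dominated convergence for the ratio).

Stubs (registered on the crux; `sorry` only here):
* `stub_flatModeCondensate` — flat-mode condensation of `Ψ₀`, bounded `v`: `L³ ≤ C ∫ s₀²`
  (equivalently `occ(φ₀, Ψ₀) ≥ N/C`). OPEN-PROBLEM STRENGTH (it is BEC of the ground state into the
  flat Dirichlet mode); the card reaches it at the KL level from (S1) + a healing-scale log-Sobolev
  inequality for `ν₀`.
* `stub_removalChiSq` — the `L²`-excess of the crux over BEC, bounded `v`:
  `(∫ s₀²)(∫ m₀²/s₀²) ≤ C`, i.e. `χ²(Q‖ν₀) ≤ C - 1` for `Ψ₀`. OPEN; the card's target proper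
  ((S1)–(S2) + effective Poincaré for the single observable `F = dQ/dν₀`).
* `stub_witnessOfGroundState` — TRANSFER at fixed `(n, L)`, bounded `v`: a landscape bound `≤ C` for
  `Ψ₀` yields, for every `δ > 0`, a nonnegative `δ`-near-minimising trial state with landscape ratio
  `≤ C + 1`. Provable now from the landed toolkit (`exists_trialState_energy_le`,
  `landscape_witness`, `GroundStateFeynmanKac.fkGroundState`).
* `stub_singularPotentials` — the crux VERBATIM restricted to admissible `v` that are NOT bounded
  (`⊤`-valued hard cores, non-`L^∞` repulsions). NOT reduced by this line (no Feynman–Kac ground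
  state with the needed regularisation exists in the tree for such `v`; shared obstacle with item
  stmt-AtomisticToContinuum-14978 `WitnessTransfer`, part VI). Honest remainder.

Glue proved here: `lintegral_ratio_le_of_flat_of_chi` (the split inequality, pure `[0,∞]` algebra)
and the composition `LandscapeBound_of` (case split on boundedness of `v`; `ρ₀ = min`,
`C = C₁ C₂ + 1`).
-/

noncomputable section

open MeasureTheory Filter Set
open scoped ENNReal NNReal Topology

namespace Summit.AtomisticToContinuum.BoseEinsteinCondensation.Theorems

open Literature.MathematicalPhysics.QuantumManyBody.BoseGas
open Summit.AtomisticToContinuum.BoseEinsteinCondensation.Theses.BECCutLineWeakDisorder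

namespace LandscapeBoundLine

/-! ### Stubs -/

/-- **Stub (open-problem strength): flat-mode condensation of the Feynman–Kac ground state.**
For a bounded admissible `v`, all small `ρ`, some `C` and all large `n`: with `L = ((n+1)/ρ)^{1/3}`
and `Ψ₀ = fkGroundState v (n+1) L`, `L³ ≤ C · ∫ (∫ Ψ₀(x,Y) dx)² dY`, i.e. the flat Dirichlet mode
`φ₀ = L^{-3/2} 1_Λ` has occupation `≥ (n+1)/C` in `Ψ₀`. [folklore] -/
theorem stub_flatModeCondensate :
    ∀ v : ℝ → ℝ≥0∞, IsRepulsiveFiniteRange v → (∃ K : ℝ≥0, ∀ r, v r ≤ K) →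
      ∃ ρ₀ : ℝ, 0 < ρ₀ ∧ ∀ ρ : ℝ, 0 < ρ → ρ < ρ₀ → ∃ C : ℝ, 0 < C ∧ ∀ᶠ n : ℕ in atTop,
        ENNReal.ofReal (sideLength ρ (n + 1) ^ 3) ≤ ENNReal.ofReal C *
          ∫⁻ Y : Config n, (∫⁻ x, (‖fkGroundState v (n + 1) (sideLength ρ (n + 1))
            (Matrix.vecCons x Y)‖₊ : ℝ≥0∞)) ^ 2 := by
  sorry

/-- **Stub (open): bounded `χ²` of deletion against condensate removal for the ground state.**
For a bounded admissible `v`, all small `ρ`, some `C` and all large `n`: with `L = ((n+1)/ρ)^{1/3}`,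
`Ψ₀ = fkGroundState v (n+1) L`, `s₀(Y) = ∫ Ψ₀(x,Y) dx`, `m₀(Y) = ∫ Ψ₀(x,Y)² dx`:
`(∫ s₀²) · ∫ m₀²/s₀² ≤ C` (`= 1 + χ²(Q‖ν₀)`, `Q = m₀ dY`, `ν₀ = s₀² dY/∫ s₀²`). [folklore] -/
theorem stub_removalChiSq :
    ∀ v : ℝ → ℝ≥0∞, IsRepulsiveFiniteRange v → (∃ K : ℝ≥0, ∀ r, v r ≤ K) →
      ∃ ρ₀ : ℝ, 0 < ρ₀ ∧ ∀ ρ : ℝ, 0 < ρ → ρ < ρ₀ → ∃ C : ℝ, 0 < C ∧ ∀ᶠ n : ℕ in atTop,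
        (∫⁻ Y : Config n, (∫⁻ x, (‖fkGroundState v (n + 1) (sideLength ρ (n + 1))
            (Matrix.vecCons x Y)‖₊ : ℝ≥0∞)) ^ 2) *
          ∫⁻ Y : Config n, (∫⁻ x, (‖fkGroundState v (n + 1) (sideLength ρ (n + 1))
              (Matrix.vecCons x Y)‖₊ : ℝ≥0∞) ^ 2) ^ 2 /
            (∫⁻ x, (‖fkGroundState v (n + 1) (sideLength ρ (n + 1))
              (Matrix.vecCons x Y)‖₊ : ℝ≥0∞)) ^ 2 ≤ ENNReal.ofReal C := by
  sorry

/-- **Stub (transfer, provable now): from a ground-state landscape bound to near-minimising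
witnesses.** For a bounded admissible `v`, `L > 0`, `0 ≤ C`: if `Ψ₀ = fkGroundState v (n+1) L` has
landscape ratio `∫ L³ m₀²/s₀² ≤ C`, then for every `δ > 0` there is a NONNEGATIVE trial state
`Ψ ∈ TrialState (n+1) L` with `energy v Ψ ≤ E₀ + δ` and landscape ratio `≤ C + 1` (dilate towards the
centre, mollify, normalise: `CutLineWitness.exists_trialState_energy_le` + `landscape_witness`,
with `GroundStateFeynmanKac_holds`). [folklore] -/
theorem stub_witnessOfGroundState :
    ∀ v : ℝ → ℝ≥0∞, IsRepulsiveFiniteRange v → (∃ K : ℝ≥0, ∀ r, v r ≤ K) →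
      ∀ (n : ℕ) (L : ℝ), 0 < L → ∀ C : ℝ, 0 ≤ C →
        ∫⁻ Y : Config n, ENNReal.ofReal (L ^ 3) *
            (∫⁻ x, (‖fkGroundState v (n + 1) L (Matrix.vecCons x Y)‖₊ : ℝ≥0∞) ^ 2) ^ 2 /
              (∫⁻ x, (‖fkGroundState v (n + 1) L (Matrix.vecCons x Y)‖₊ : ℝ≥0∞)) ^ 2 ≤
          ENNReal.ofReal C →
        ∀ δ : ℝ≥0∞, 0 < δ → ∃ Ψ : TrialState (n + 1) L,
          energy v Ψ ≤ groundStateEnergy v (n + 1) L + δ ∧ (∀ X, Ψ.ψ X = (‖Ψ.ψ X‖ : ℂ)) ∧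
            ∫⁻ Y : Config n, ENNReal.ofReal (L ^ 3) *
                (∫⁻ x, (‖Ψ.ψ (Matrix.vecCons x Y)‖₊ : ℝ≥0∞) ^ 2) ^ 2 /
                  (∫⁻ x, (‖Ψ.ψ (Matrix.vecCons x Y)‖₊ : ℝ≥0∞)) ^ 2 ≤ ENNReal.ofReal (C + 1) := by
  sorry

/-- **Stub (unreduced remainder): singular potentials.** The crux verbatim, restricted to
admissible `v` that are not bounded (`⊤`-valued hard cores, unbounded repulsions). This line does not
reduce this case: the tree has no ground-state object with the needed `C¹`-regularisation for such
`v` (shared obstacle with `WitnessTransfer`, stmt-AtomisticToContinuum-14978, part VI). [folklore] -/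
theorem stub_singularPotentials :
    ∀ v : ℝ → ℝ≥0∞, IsRepulsiveFiniteRange v → (¬ ∃ K : ℝ≥0, ∀ r, v r ≤ K) →
      ∃ ρ₀ : ℝ, 0 < ρ₀ ∧ ∀ ρ : ℝ, 0 < ρ → ρ < ρ₀ → ∃ C : ℝ, 0 < C ∧ ∀ᶠ n : ℕ in atTop,
        ∀ δ : ℝ≥0∞, 0 < δ → ∃ Ψ : TrialState (n + 1) (sideLength ρ (n + 1)),
          energy v Ψ ≤ groundStateEnergy v (n + 1) (sideLength ρ (n + 1)) + δ ∧
            (∀ X, Ψ.ψ X = (‖Ψ.ψ X‖ : ℂ)) ∧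
            ∫⁻ Y : Config n, ENNReal.ofReal (sideLength ρ (n + 1) ^ 3) *
                (∫⁻ x, (‖Ψ.ψ (Matrix.vecCons x Y)‖₊ : ℝ≥0∞) ^ 2) ^ 2 /
                  (∫⁻ x, (‖Ψ.ψ (Matrix.vecCons x Y)‖₊ : ℝ≥0∞)) ^ 2 ≤ ENNReal.ofReal C := by
  sorry

/-! ### Glue (proved) -/

/-- **The split inequality** (card `fisher-sum-rule-deletion-removal`, first lemma, one direction;
pure `[0, ∞]` algebra): if `A ≤ C₁ · ∫ s²` and `(∫ s²) · ∫ m²/s² ≤ C₂` then `∫ A · m²/s² ≤ C₁ C₂`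
(`A = L³`; no measurability needed). [folklore] -/
theorem lintegral_ratio_le_of_flat_of_chi {α : Type*} [MeasurableSpace α] {μ : Measure α}
    {m s : α → ℝ≥0∞} {A : ℝ≥0∞} (hA : A ≠ ⊤) {C₁ C₂ : ℝ} (hC₁ : 0 ≤ C₁)
    (hflat : A ≤ ENNReal.ofReal C₁ * ∫⁻ Y, s Y ^ 2 ∂μ)
    (hchi : (∫⁻ Y, s Y ^ 2 ∂μ) * ∫⁻ Y, m Y ^ 2 / s Y ^ 2 ∂μ ≤ ENNReal.ofReal C₂) :
    ∫⁻ Y, A * m Y ^ 2 / s Y ^ 2 ∂μ ≤ ENNReal.ofReal (C₁ * C₂) := by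
  calc ∫⁻ Y, A * m Y ^ 2 / s Y ^ 2 ∂μ = ∫⁻ Y, A * (m Y ^ 2 / s Y ^ 2) ∂μ := by
        simp_rw [mul_div_assoc]
    _ = A * ∫⁻ Y, m Y ^ 2 / s Y ^ 2 ∂μ := lintegral_const_mul' _ _ hA
    _ ≤ (ENNReal.ofReal C₁ * ∫⁻ Y, s Y ^ 2 ∂μ) * ∫⁻ Y, m Y ^ 2 / s Y ^ 2 ∂μ := by gcongr
    _ = ENNReal.ofReal C₁ * ((∫⁻ Y, s Y ^ 2 ∂μ) * ∫⁻ Y, m Y ^ 2 / s Y ^ 2 ∂μ) := mul_assoc _ _ _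
    _ ≤ ENNReal.ofReal C₁ * ENNReal.ofReal C₂ := by gcongr
    _ = ENNReal.ofReal (C₁ * C₂) := (ENNReal.ofReal_mul hC₁).symm

/-- The side length `L = ((n+1)/ρ)^{1/3}` is positive for `ρ > 0`. [folklore] -/
theorem sideLength_succ_pos {ρ : ℝ} (hρ : 0 < ρ) (n : ℕ) : 0 < sideLength ρ (n + 1) :=
  Real.rpow_pos_of_pos (div_pos (Nat.cast_pos.mpr n.succ_pos) hρ) _

/-! ### Composition: the crux by name, modulo the stubs -/

/-- **`LandscapeBound` from the stubs** (line `Sketch` / card `fisher-sum-rule-deletion-removal`):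
for bounded `v`, `ρ₀ = min` of the two thresholds, `C = C₁ C₂ + 1`; eventually in `n` the split
inequality bounds the landscape ratio of `Ψ₀ = fkGroundState` by `C₁ C₂` and the transfer stub
supplies the nonnegative `δ`-near-minimiser for every `δ > 0`; singular `v` is the remainder stub.
[folklore] -/
theorem LandscapeBound_of : LandscapeBound := by
  intro v hv
  by_cases hb : ∃ K : ℝ≥0, ∀ r, v r ≤ K
  · obtain ⟨ρ₁, hρ₁, H1⟩ := stub_flatModeCondensate v hv hb
    obtain ⟨ρ₂, hρ₂, H2⟩ := stub_removalChiSq v hv hb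
    refine ⟨min ρ₁ ρ₂, lt_min hρ₁ hρ₂, fun ρ hρ hρlt => ?_⟩
    obtain ⟨C₁, hC₁, ev1⟩ := H1 ρ hρ (hρlt.trans_le (min_le_left _ _))
    obtain ⟨C₂, hC₂, ev2⟩ := H2 ρ hρ (hρlt.trans_le (min_le_right _ _))
    refine ⟨C₁ * C₂ + 1, by positivity, ?_⟩
    filter_upwards [ev1, ev2] with n h1 h2
    intro δ hδ
    have hratio := lintegral_ratio_le_of_flat_of_chi (μ := volume) ENNReal.ofReal_ne_top hC₁.le h1 h2
    exact stub_witnessOfGroundState v hv hb n _ (sideLength_succ_pos hρ n) (C₁ * C₂)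
      (by positivity) hratio δ hδ
  · exact stub_singularPotentials v hv hb

end LandscapeBoundLine

end Summit.AtomisticToContinuum.BoseEinsteinCondensation.Theorems

end
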